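import Mathlib
import Summits.MatrixMultiplication.MatrixMultiplication.Theses.EisensteinValCertificates
import Literature.Combinatorics.Additive.TightTriangleRemovalProofs
import Summits.MatrixMultiplication.MatrixMultiplication.Theorems.EisensteinValCertificatesHomocyclicSTPPDesignsLargeBlockTools

/-!
# The large-block transfer: abelian STPP designs with large blocks give `HomocyclicSTPPDesigns`

Crux `EisensteinValCertificates.HomocyclicSTPPDesigns` (stmt-MatrixMultiplication-10647) = X′: for every
`ε > 0` some prime power `q`, some `ℓ` and some STPP family in `(ℤ/q)^ℓ` with
`q^ℓ < Σ_i (|A_i||B_i||C_i|)^{(2+ε)/3}`.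

`homocyclicSTPPDesigns_of_largeBlockAbelianDesigns` (the crux strategist's typed transfer
`largeBlockTransfer`, Cruxes/HomocyclicSTPPDesigns/SketchStrategist.lean §3, STRATEGY-CENSUS.md T1/R1,
here PROVED): if for ONE fixed `α₀ > 0` and EVERY `ε > 0` some finite abelian group `H` carries an STPP
family beating exponent `(2+ε)/3` whose every block has volume `|A_i||B_i||C_i| ≥ |H|^{α₀}`
("large-block abelian designs" — the SDPP lift of CKSU 2005 §6 produces such families with `α₀ → 1`),
then X′ holds, with witnesses in PRIME CYCLIC hosts (`ℓ = 1`, `q` prime).  Contrapositive (kill side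
of the route): the negative milestone `NoHomocyclicSTPP` excludes large-block STPP designs in EVERY
finite abelian group — the case Pratt 2024 Rem. 4.6 leaves open for Thm 4.4.

Proof = Umans' cyclic reduction (Pratt 2024, arXiv:2309.03878 p. 10; tree template
`Theorems/FourierTwoFamiliesModPCyclicReduction.lean`) run on STPP families: given `ε`, (1) fix `L` with
`log L ≥ 24 log 3/(α₀ε)` and `ε' := min(ε/2, α₀εΛ/(8L log 3))`, `Λ = min_{q ≤ L} log(1/θ_q)`;
(2) take the hypothesis at `ε'` and BOOST it by a tensor power (`exists_boost`) so that
`log|K| ≥ 12 log 2/(α₀ε) + 1`; (3) decompose `K ≃ ∏_{j<k} ℤ/m_j`, `k = k_L + Σ_{q≤L} r_q`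
(`exists_pi_zmod_decomp`); the slice-rank bound for general STPP families (tools file) gives
`r_q Λ ≤ (ε'/3) log|K|` (`card_mul_neg_log_le`), whence `k log 3 ≤ (α₀ε/12) log|K|`; (4) re-host in
`ℤ/P`, `P` prime, `P ≤ 2·3^k·|K|`; (5) the exponent gain on blocks `≥ |K|^{α₀}` gives
`Σ (abc)^{(2+ε)/3} > |K|^{1+α₀ε/6} ≥ 2·3^k·|K| ≥ P`; (6) embed `ℤ/P ↪ (Fin 1 → ℤ/P)`.
`not_largeBlockAbelianDesigns_of_noHomocyclicSTPP` is the kill-side contrapositive (census K1/R1): the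
route's negative milestone `NoHomocyclicSTPP` excludes large-block designs in every finite abelian group.
-/

-- single-conjunct summit: the mandated namespace repeats `MatrixMultiplication` (summit = sub-problem).
set_option linter.dupNamespace false

namespace Summit.MatrixMultiplication.MatrixMultiplication.Theorems.HomocyclicSTPPDesigns.LargeBlock

open Finset Literature.Computability.AlgebraicComplexity Literature.Combinatorics.Additive
  Summit.MatrixMultiplication.MatrixMultiplication.Theses.EisensteinValCertificates
open scoped BigOperators

/-! ## Step 0: a beating family lives in a group with at least two elements -/
/-- An STPP family with blocks of volume `≥ |K|^{α₀}` that beats `|K|` at some exponent `τ` lives in a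
group with `|K| ≥ 2`: in the trivial group every block is `({0},{0},{0})`, the STPP then forces
`N ≤ 1`, and the packing sum is `≤ 1 = |K|`. -/
theorem one_lt_card_of_beats {K : Type} [AddCommGroup K] [Fintype K] {N : ℕ}
    {A B C : Fin N → Finset K} (hS : IsSTPP A B C) {α₀ τ : ℝ}
    (hvol : ∀ i, (Fintype.card K : ℝ) ^ α₀ ≤ (((A i).card * (B i).card * (C i).card : ℕ) : ℝ))
    (hbeat : (Fintype.card K : ℝ) <
      ∑ i, (((A i).card * (B i).card * (C i).card : ℕ) : ℝ) ^ τ) :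
    1 < Fintype.card K := by
  classical
  by_contra hle
  push Not at hle
  have hK1 : Fintype.card K = 1 := le_antisymm hle Fintype.card_pos
  haveI : Subsingleton K := Fintype.card_le_one_iff_subsingleton.1 hle
  have hS' := (isSTPP_iff_addSimultaneousTPP A B C).1 hS
  -- every block has volume exactly 1, hence nonempty sets
  have hvol1 : ∀ i, (A i).card * (B i).card * (C i).card = 1 := by
    intro i
    have h1 : (A i).card * (B i).card * (C i).card ≤ 1 := hK1 ▸ hS'.card_mul_card_mul_card_le i
    have h2 : (1 : ℝ) ≤ (((A i).card * (B i).card * (C i).card : ℕ) : ℝ) := by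
      have := hvol i
      rwa [hK1, Nat.cast_one, Real.one_rpow] at this
    have h3 : 1 ≤ (A i).card * (B i).card * (C i).card := by exact_mod_cast h2
    omega
  have hne : ∀ i, (A i).Nonempty ∧ (B i).Nonempty ∧ (C i).Nonempty := by
    intro i
    have h := hvol1 i
    refine ⟨Finset.card_pos.1 (Nat.pos_of_ne_zero fun h0 => ?_),
      Finset.card_pos.1 (Nat.pos_of_ne_zero fun h0 => ?_),
      Finset.card_pos.1 (Nat.pos_of_ne_zero fun h0 => ?_)⟩ <;> simp [h0] at h
  -- the STPP forces all indices to coincide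
  have hsub : ∀ i j : Fin N, i = j := by
    intro i j
    obtain ⟨s, hs⟩ := (hne j).1
    obtain ⟨s', hs'⟩ := (hne i).1
    obtain ⟨t, ht⟩ := (hne i).2.1
    obtain ⟨t', ht'⟩ := (hne j).2.1
    obtain ⟨u, hu⟩ := (hne j).2.2
    obtain ⟨u', hu'⟩ := (hne j).2.2
    exact (hS i j j s hs s' hs' t ht t' ht' u hu u' hu' (Subsingleton.elim _ _)).1
  have hN : Fintype.card (Fin N) ≤ 1 := Fintype.card_le_one_iff.2 hsub
  rw [Fintype.card_fin] at hN
  -- the packing sum is then at most 1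
  have hsum : ∑ i, (((A i).card * (B i).card * (C i).card : ℕ) : ℝ) ^ τ ≤ 1 := by
    calc ∑ i, (((A i).card * (B i).card * (C i).card : ℕ) : ℝ) ^ τ = ∑ _i : Fin N, (1 : ℝ) := by
          refine Finset.sum_congr rfl fun i _ => ?_
          rw [hvol1 i, Nat.cast_one, Real.one_rpow]
      _ = N := by rw [Finset.sum_const, Finset.card_univ, Fintype.card_fin, nsmul_eq_mul, mul_one]
      _ ≤ 1 := by exact_mod_cast hN
  rw [hK1, Nat.cast_one] at hbeat
  linarith
/-! ## Step 1: boosting a large-block design by tensor powers -/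
/-- **Boost**: a large-block STPP design beating `2+ε'` in some finite abelian group can be replaced by
one in an arbitrarily LARGE group (its `m`-th tensor power in `K^m`: STPP by `isSTPP_piPow`, blocks
`≥ (|K|^{α₀})^m = |K^m|^{α₀}` by `pow_le_vol_piPow`, packing sum `= S^m > |K|^m` by `sum_rpow_piPow`). -/
theorem exists_boost {α₀ ε' : ℝ} (T : ℝ)
    (h : ∃ (H : Type) (_ : AddCommGroup H) (_ : Fintype H) (N : ℕ) (A B C : Fin N → Finset H),
      IsSTPP A B C ∧
      (∀ i, (Fintype.card H : ℝ) ^ α₀ ≤ (((A i).card * (B i).card * (C i).card : ℕ) : ℝ)) ∧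
      (Fintype.card H : ℝ) < ∑ i, (((A i).card * (B i).card * (C i).card : ℕ) : ℝ) ^ ((2 + ε') / 3)) :
    ∃ (H : Type) (_ : AddCommGroup H) (_ : Fintype H) (N : ℕ) (A B C : Fin N → Finset H),
      IsSTPP A B C ∧
      (∀ i, (Fintype.card H : ℝ) ^ α₀ ≤ (((A i).card * (B i).card * (C i).card : ℕ) : ℝ)) ∧
      (Fintype.card H : ℝ) < ∑ i, (((A i).card * (B i).card * (C i).card : ℕ) : ℝ) ^ ((2 + ε') / 3) ∧
      T ≤ Real.log (Fintype.card H) := by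
  obtain ⟨K₀, _i1, _i2, N, A, B, C, hS, hvol, hbeat⟩ := h
  have hK₀ : 1 < Fintype.card K₀ := one_lt_card_of_beats hS hvol hbeat
  have hK₀pos : (0 : ℝ) < Fintype.card K₀ := by exact_mod_cast Fintype.card_pos
  have hK₀1 : (1 : ℝ) < Fintype.card K₀ := by exact_mod_cast hK₀
  set ℓ₀ : ℝ := Real.log (Fintype.card K₀) with hℓ₀
  have hℓ₀pos : 0 < ℓ₀ := Real.log_pos hK₀1
  set m : ℕ := ⌈T / ℓ₀⌉₊ + 1 with hm
  have hm0 : m ≠ 0 := by omega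
  have hTm : T ≤ m * ℓ₀ := by
    have h1 : T / ℓ₀ ≤ m := by
      have h2 := Nat.le_ceil (T / ℓ₀)
      have h3 : (⌈T / ℓ₀⌉₊ : ℝ) ≤ m := by rw [hm]; push_cast; linarith
      linarith
    rwa [div_le_iff₀ hℓ₀pos] at h1
  refine ⟨Fin m → K₀, inferInstance, inferInstance, N ^ m,
    fun w => Fintype.piFinset fun l : Fin m => A (finFunctionFinEquiv.symm w l),
    fun w => Fintype.piFinset fun l : Fin m => B (finFunctionFinEquiv.symm w l),
    fun w => Fintype.piFinset fun l : Fin m => C (finFunctionFinEquiv.symm w l),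
    isSTPP_piPow hS m, ?_, ?_, ?_⟩
  · -- blocks
    intro w
    have hcard : (Fintype.card (Fin m → K₀) : ℝ) ^ α₀ = ((Fintype.card K₀ : ℝ) ^ α₀) ^ m := by
      rw [Fintype.card_fun, Fintype.card_fin, Nat.cast_pow, ← Real.rpow_natCast,
        ← Real.rpow_mul hK₀pos.le, mul_comm, Real.rpow_mul hK₀pos.le, Real.rpow_natCast]
    rw [hcard]
    exact pow_le_vol_piPow A B C m (Real.rpow_nonneg hK₀pos.le _) hvol w
  · -- beating
    rw [sum_rpow_piPow, Fintype.card_fun, Fintype.card_fin, Nat.cast_pow]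
    exact pow_lt_pow_left₀ hbeat hK₀pos.le hm0
  · -- size
    rw [Fintype.card_fun, Fintype.card_fin, Nat.cast_pow, Real.log_pow]
    exact hTm
/-! ## Step 2: the number of small cyclic factors of a witness host -/
/-- **Few small cyclic factors** (slice rank): if `K ≃ (ℤ/q)^κ × G'` with `q = p^s` a prime power,
`θ = θ_q`, and `K` carries an STPP family beating exponent `(2+ε')/3` (`ε' ≥ 0`), then
`|κ| · log(1/θ) ≤ (ε'/3) · log|K|`: by `sum_rpow_two_thirds_le_of_addEquiv_piZMod` and `abc ≤ |K|`,
`|K| < Σ (abc)^{(2+ε')/3} ≤ |K|^{ε'/3} θ^{|κ|} |K|`. -/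
theorem card_mul_neg_log_le {K : Type} [AddCommGroup K] [Fintype K] [DecidableEq K]
    (hK : 1 < Fintype.card K) {N : ℕ} {A B C : Fin N → Finset K} (hS : IsSTPP A B C)
    {ε' : ℝ} (hε' : 0 ≤ ε')
    (hbeat : (Fintype.card K : ℝ) <
      ∑ i, (((A i).card * (B i).card * (C i).card : ℕ) : ℝ) ^ ((2 + ε') / 3))
    {p : ℕ} [Fact p.Prime] {q : ℕ} [NeZero q] (s : ℕ) (hq : q = p ^ s)
    {κ : Type} [Fintype κ] [DecidableEq κ] {G' : Type} [AddCommGroup G'] [Fintype G']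
    [DecidableEq G'] (e : K ≃+ (κ → ZMod q) × G') {θ : ℝ} (hθ0 : 0 < θ)
    (hθ : ∀ (κ' : Type) [Fintype κ'] [DecidableEq κ'],
      (Fintype.card (LowWeight q κ') : ℝ) ≤ (θ * q) ^ Fintype.card κ') :
    (Fintype.card κ : ℝ) * (-Real.log θ) ≤ ε' / 3 * Real.log (Fintype.card K) := by
  have hS' := (isSTPP_iff_addSimultaneousTPP A B C).1 hS
  have hKpos : (0 : ℝ) < Fintype.card K := by exact_mod_cast Fintype.card_pos
  have h23 := sum_rpow_two_thirds_le_of_addEquiv_piZMod hK hS s hq e hθ0 hθ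
  -- `Σ (abc)^{(2+ε')/3} ≤ |K|^{ε'/3} Σ (abc)^{2/3}`
  have hsplit : ∑ i, (((A i).card * (B i).card * (C i).card : ℕ) : ℝ) ^ ((2 + ε') / 3) ≤
      (Fintype.card K : ℝ) ^ (ε' / 3) *
        ∑ i, (((A i).card * (B i).card * (C i).card : ℕ) : ℝ) ^ ((2 : ℝ) / 3) := by
    rw [Finset.mul_sum]
    refine Finset.sum_le_sum fun i _ => ?_
    have hexp : (2 + ε') / 3 = ε' / 3 + (2 : ℝ) / 3 := by ring
    rw [hexp, Real.rpow_add' (by positivity) (by positivity)]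
    refine mul_le_mul_of_nonneg_right ?_ (by positivity)
    refine Real.rpow_le_rpow (by positivity) ?_ (by positivity)
    exact_mod_cast hS'.card_mul_card_mul_card_le i
  have hθκ : 0 < θ ^ Fintype.card κ := pow_pos hθ0 _
  have hlt : (Fintype.card K : ℝ) <
      (Fintype.card K : ℝ) ^ (ε' / 3) * (θ ^ Fintype.card κ * Fintype.card K) := by
    calc (Fintype.card K : ℝ) < _ := hbeat
      _ ≤ _ := hsplit
      _ ≤ _ := mul_le_mul_of_nonneg_left h23 (by positivity)
  have hlt1 : 1 < (Fintype.card K : ℝ) ^ (ε' / 3) * θ ^ Fintype.card κ := by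
    have h1 : (Fintype.card K : ℝ) * 1 <
        (Fintype.card K : ℝ) * ((Fintype.card K : ℝ) ^ (ε' / 3) * θ ^ Fintype.card κ) := by
      rw [mul_one]; linarith [hlt]
    exact lt_of_mul_lt_mul_left h1 hKpos.le
  have hlog := Real.log_lt_log one_pos hlt1
  rw [Real.log_one, Real.log_mul (Real.rpow_pos_of_pos hKpos _).ne' hθκ.ne', Real.log_rpow hKpos,
    Real.log_pow] at hlog
  linarith
/-! ## Step 3: the transfer -/
/-- **Large-block transfer** (`LargeBlockAbelianDesigns → HomocyclicSTPPDesigns`, the crux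
strategist's typed `largeBlockTransfer`): STPP designs in arbitrary finite abelian groups whose every
block has volume `≥ |H|^{α₀}` for one fixed `α₀ > 0`, beating every exponent `2+ε`, give X′ (with
`ℓ = 1`, `q` prime).  Proof in the module docstring. -/
theorem homocyclicSTPPDesigns_of_largeBlockAbelianDesigns :
    (∃ α₀ : ℝ, 0 < α₀ ∧ ∀ ε : ℝ, 0 < ε →
      ∃ (H : Type) (_ : AddCommGroup H) (_ : Fintype H) (N : ℕ) (A B C : Fin N → Finset H),
        IsSTPP A B C ∧
        (∀ i, (Fintype.card H : ℝ) ^ α₀ ≤ (((A i).card * (B i).card * (C i).card : ℕ) : ℝ)) ∧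
        (Fintype.card H : ℝ) <
          ∑ i, (((A i).card * (B i).card * (C i).card : ℕ) : ℝ) ^ ((2 + ε) / 3)) →
    HomocyclicSTPPDesigns := by
  intro h ε hε
  obtain ⟨α₀, hα₀, hfam⟩ := h
  classical
  /- ### constants -/
  set c3 : ℝ := Real.log 3 with hc3
  have hc3pos : 0 < c3 := Real.log_pos (by norm_num)
  have hαε : 0 < α₀ * ε := mul_pos hα₀ hε
  set L : ℕ := ⌈Real.exp (24 * c3 / (α₀ * ε))⌉₊ + 2 with hL
  have hL2 : 2 ≤ L := by omega
  have hLpos : (0 : ℝ) < L := by exact_mod_cast (show 0 < L by omega)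
  have hlogL : 24 * c3 / (α₀ * ε) ≤ Real.log L := by
    have h1 : Real.exp (24 * c3 / (α₀ * ε)) ≤ L := by
      have h2 := Nat.le_ceil (Real.exp (24 * c3 / (α₀ * ε)))
      have h3 : (⌈Real.exp (24 * c3 / (α₀ * ε))⌉₊ : ℝ) ≤ L := by rw [hL]; push_cast; linarith
      linarith
    have h4 := Real.log_le_log (Real.exp_pos _) h1
    rwa [Real.log_exp] at h4
  have hlogLpos : 0 < Real.log L := lt_of_lt_of_le (by positivity) hlogL
  choose θ hθpos hθ using Literature.Combinatorics.Additive.exists_theta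
  have hne : (Icc 2 L).Nonempty := ⟨2, mem_Icc.2 ⟨le_rfl, hL2⟩⟩
  set Λ : ℝ := (Icc 2 L).inf' hne fun q => -Real.log (θ q) with hΛ
  have hΛpos : 0 < Λ := by
    rw [hΛ, Finset.lt_inf'_iff]
    intro q hq
    have hq2 : 2 ≤ q := (mem_Icc.1 hq).1
    have := Real.log_neg (hθpos q) ((hθ q hq2).1)
    linarith
  have hΛle : ∀ q ∈ Icc 2 L, Λ ≤ -Real.log (θ q) := fun q hq =>
    Finset.inf'_le (fun q => -Real.log (θ q)) hq
  set ε' : ℝ := min (ε / 2) (α₀ * ε * Λ / (8 * L * c3)) with hε'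
  have hε'pos : 0 < ε' := lt_min (by positivity) (by positivity)
  have hε'le : ε' ≤ ε / 2 := min_le_left _ _
  have hε'le' : ε' ≤ α₀ * ε * Λ / (8 * L * c3) := min_le_right _ _
  /- ### the boosted large-block design at `ε'` -/
  obtain ⟨K, _i1, _i2, N, A, B, C, hS, hvol, hbeat, hlogK⟩ :=
    exists_boost (12 * Real.log 2 / (α₀ * ε) + 1) (hfam ε' hε'pos)
  have hKpos : (0 : ℝ) < Fintype.card K := by exact_mod_cast Fintype.card_pos
  set ℓK : ℝ := Real.log (Fintype.card K) with hℓK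
  have hlog2 : 0 < Real.log 2 := Real.log_pos (by norm_num)
  have hℓKpos : 0 < ℓK := by linarith [(by positivity : 0 < 12 * Real.log 2 / (α₀ * ε) + 1)]
  have hK1 : 1 < Fintype.card K := by
    by_contra hle
    push Not at hle
    have : (Fintype.card K : ℝ) ≤ 1 := by exact_mod_cast hle
    have := Real.log_nonpos hKpos.le this
    linarith
  -- the margin: `(α₀ ε / 12) log|K| ≥ log 2 + α₀ ε / 12 > log 2`
  have hmargin : Real.log 2 < α₀ * ε / 12 * ℓK := by
    have h1 : α₀ * ε / 12 * (12 * Real.log 2 / (α₀ * ε) + 1) ≤ α₀ * ε / 12 * ℓK :=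
      mul_le_mul_of_nonneg_left hlogK (by positivity)
    have h2 : α₀ * ε / 12 * (12 * Real.log 2 / (α₀ * ε) + 1) = Real.log 2 + α₀ * ε / 12 := by
      field_simp
    rw [h2] at h1
    linarith
  /- ### the cyclic decomposition and the count of small factors -/
  obtain ⟨k, m, hm2, ⟨e⟩, hprod, kL, r, hk, hLk, hhomo⟩ := exists_pi_zmod_decomp K L
  have hr : ∀ q ∈ Icc 2 L, Λ * r q ≤ ε' / 3 * ℓK := by
    intro q hq
    rcases Nat.eq_zero_or_pos (r q) with h0 | hrpos
    · rw [h0, Nat.cast_zero, mul_zero]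
      positivity
    obtain ⟨p, hp, s, hqps, κ, _, _, G', _, _, _, hκ, ⟨e'⟩⟩ := hhomo q hq hrpos.ne'
    haveI : Fact p.Prime := ⟨hp⟩
    have hq2 : 2 ≤ q := (mem_Icc.1 hq).1
    haveI : NeZero q := ⟨by omega⟩
    have hb := card_mul_neg_log_le hK1 hS hε'pos.le hbeat s hqps e' (hθpos q) (hθ q hq2).2
    rw [hκ] at hb
    calc Λ * r q = r q * Λ := mul_comm _ _
      _ ≤ r q * (-Real.log (θ q)) := mul_le_mul_of_nonneg_left (hΛle q hq) (Nat.cast_nonneg _)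
      _ ≤ ε' / 3 * ℓK := hb
  have hsumr : Λ * ((∑ q ∈ Icc 2 L, r q : ℕ) : ℝ) ≤ L * (ε' / 3 * ℓK) := by
    push_cast
    rw [Finset.mul_sum]
    calc ∑ q ∈ Icc 2 L, Λ * (r q : ℝ) ≤ ∑ _q ∈ Icc 2 L, (ε' / 3 * ℓK) := sum_le_sum hr
      _ = (#(Icc 2 L) : ℝ) * (ε' / 3 * ℓK) := by rw [sum_const, nsmul_eq_mul]
      _ ≤ L * (ε' / 3 * ℓK) := by
          refine mul_le_mul_of_nonneg_right ?_ (by positivity)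
          have : #(Icc 2 L) ≤ L := by rw [Nat.card_Icc]; omega
          exact_mod_cast this
  have hkL : (kL : ℝ) * Real.log L ≤ ℓK := by
    have h1 : ((L ^ kL : ℕ) : ℝ) ≤ Fintype.card K := by exact_mod_cast hLk
    have h2 := Real.log_le_log (by exact_mod_cast pow_pos (show 0 < L by omega) kL) h1
    rwa [Nat.cast_pow, Real.log_pow] at h2
  have hkR : (k : ℝ) = kL + ((∑ q ∈ Icc 2 L, r q : ℕ) : ℝ) := by exact_mod_cast hk
  -- `c3 kL ≤ (α₀ ε / 24) log|K|`
  have hkL' : c3 * kL ≤ α₀ * ε / 24 * ℓK := by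
    have h24 : 24 * c3 ≤ α₀ * ε * Real.log L := by
      have := (div_le_iff₀ hαε).1 hlogL
      linarith
    have hkL0 : (0 : ℝ) ≤ kL := Nat.cast_nonneg _
    -- multiply the claim by `log L > 0`
    have h1 : c3 * kL * Real.log L ≤ c3 * ℓK := by
      have := mul_le_mul_of_nonneg_left hkL hc3pos.le
      linarith [this]
    have h2 : c3 * ℓK ≤ α₀ * ε * Real.log L / 24 * ℓK := by
      refine mul_le_mul_of_nonneg_right ?_ hℓKpos.le
      linarith
    have h3 : c3 * kL * Real.log L ≤ (α₀ * ε / 24 * ℓK) * Real.log L := by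
      calc c3 * kL * Real.log L ≤ c3 * ℓK := h1
        _ ≤ α₀ * ε * Real.log L / 24 * ℓK := h2
        _ = (α₀ * ε / 24 * ℓK) * Real.log L := by ring
    exact le_of_mul_le_mul_right h3 hlogLpos
  -- `c3 Σ r ≤ (α₀ ε / 24) log|K|`
  have hsumr' : c3 * ((∑ q ∈ Icc 2 L, r q : ℕ) : ℝ) ≤ α₀ * ε / 24 * ℓK := by
    -- from `Λ Σr ≤ L ε' ℓK / 3` and `ε' ≤ α₀ ε Λ / (8 L c3)`
    have h1 : c3 * ((∑ q ∈ Icc 2 L, r q : ℕ) : ℝ) * Λ ≤ c3 * (L * (ε' / 3 * ℓK)) := by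
      have := mul_le_mul_of_nonneg_left hsumr hc3pos.le
      linarith [this]
    have h2 : c3 * (L * (ε' / 3 * ℓK)) ≤ (α₀ * ε / 24 * ℓK) * Λ := by
      have h3 : ε' * (8 * L * c3) ≤ α₀ * ε * Λ := by
        rwa [le_div_iff₀ (by positivity)] at hε'le'
      have h4 : 0 ≤ ℓK := hℓKpos.le
      nlinarith [h3, h4, mul_nonneg h4 hΛpos.le]
    exact le_of_mul_le_mul_right (h1.trans h2) hΛpos
  have hkc3 : (k : ℝ) * c3 ≤ α₀ * ε / 12 * ℓK := by
    rw [hkR, add_mul, mul_comm (kL : ℝ), mul_comm ((∑ q ∈ Icc 2 L, r q : ℕ) : ℝ)]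
    linarith [hkL', hsumr']
  /- ### the prime cyclic host -/
  have hm0 : ∀ j, 0 < m j := fun j => by have := hm2 j; omega
  obtain ⟨P, hP, hPle, A', B', C', hS', hcard'⟩ := exists_prime_isSTPP_of_addEquiv hS hm0 e
  have hPpos : (0 : ℝ) < P := by exact_mod_cast hP.pos
  have hlogP : Real.log P ≤ Real.log 2 + k * c3 + ℓK := by
    have hPR : (P : ℝ) ≤ 2 * ((3 : ℝ) ^ k * Fintype.card K) := by
      rw [← hprod]; exact_mod_cast hPle
    have h1 := Real.log_le_log hPpos hPR
    rw [Real.log_mul (by norm_num) (mul_pos (pow_pos (by norm_num) k) hKpos).ne',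
      Real.log_mul (pow_pos (by norm_num) k).ne' hKpos.ne', Real.log_pow] at h1
    linarith
  /- ### the exponent gain on large blocks -/
  set S : ℝ := ∑ i, (((A i).card * (B i).card * (C i).card : ℕ) : ℝ) ^ ((2 + ε) / 3) with hSdef
  have hK1r : (1 : ℝ) ≤ Fintype.card K := by exact_mod_cast hK1.le
  have hM1 : (1 : ℝ) ≤ (Fintype.card K : ℝ) ^ α₀ := Real.one_le_rpow hK1r hα₀.le
  have hgain := sum_rpow_gain_of_blocks_ge (Finset.univ : Finset (Fin N))
    (fun i => (A i).card * (B i).card * (C i).card) hM1 (by linarith : ε' ≤ ε) (fun i _ => hvol i)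
  -- `(|K|^{α₀})^{(ε-ε')/3} ≥ |K|^{α₀ ε / 6}`
  have hMexp : (Fintype.card K : ℝ) ^ (α₀ * ε / 6) ≤
      ((Fintype.card K : ℝ) ^ α₀) ^ ((ε - ε') / 3) := by
    rw [← Real.rpow_mul hKpos.le]
    refine Real.rpow_le_rpow_of_exponent_le hK1r ?_
    nlinarith [mul_nonneg hα₀.le (sub_nonneg.2 hε'le)]
  have hpowpos : 0 < (Fintype.card K : ℝ) ^ (α₀ * ε / 6) := Real.rpow_pos_of_pos hKpos _
  have hsum'nn : 0 ≤ ∑ i, (((A i).card * (B i).card * (C i).card : ℕ) : ℝ) ^ ((2 + ε') / 3) :=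
    Finset.sum_nonneg fun i _ => Real.rpow_nonneg (Nat.cast_nonneg _) _
  have hSlow : (Fintype.card K : ℝ) ^ (α₀ * ε / 6) * Fintype.card K < S := by
    calc (Fintype.card K : ℝ) ^ (α₀ * ε / 6) * Fintype.card K
        < (Fintype.card K : ℝ) ^ (α₀ * ε / 6) *
            ∑ i, (((A i).card * (B i).card * (C i).card : ℕ) : ℝ) ^ ((2 + ε') / 3) :=
          mul_lt_mul_of_pos_left hbeat hpowpos
      _ ≤ ((Fintype.card K : ℝ) ^ α₀) ^ ((ε - ε') / 3) *
            ∑ i, (((A i).card * (B i).card * (C i).card : ℕ) : ℝ) ^ ((2 + ε') / 3) :=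
          mul_le_mul_of_nonneg_right hMexp hsum'nn
      _ ≤ S := hgain
  have hlowpos : 0 < (Fintype.card K : ℝ) ^ (α₀ * ε / 6) * Fintype.card K := mul_pos hpowpos hKpos
  have hlogS : (1 + α₀ * ε / 6) * ℓK < Real.log S := by
    have h1 := Real.log_lt_log hlowpos hSlow
    rwa [Real.log_mul hpowpos.ne' hKpos.ne', Real.log_rpow hKpos, ← hℓK,
      show α₀ * ε / 6 * ℓK + ℓK = (1 + α₀ * ε / 6) * ℓK by ring] at h1
  -- `P < S`
  have hPS : (P : ℝ) < S := by
    have h1 : Real.log P < Real.log S := by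
      calc Real.log P ≤ Real.log 2 + k * c3 + ℓK := hlogP
        _ < (1 + α₀ * ε / 6) * ℓK := by linarith [hmargin, hkc3, hℓKpos]
        _ < Real.log S := hlogS
    exact (Real.log_lt_log_iff hPpos (lt_trans hlowpos hSlow)).1 h1
  have hS'sum : ∑ i, (((A' i).card * (B' i).card * (C' i).card : ℕ) : ℝ) ^ ((2 + ε) / 3) = S := by
    refine Finset.sum_congr rfl fun i _ => ?_
    obtain ⟨h1, h2, h3⟩ := hcard' i
    rw [h1, h2, h3]
  /- ### embed `ℤ/P ↪ (Fin 1 → ℤ/P)` -/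
  haveI : Fact P.Prime := ⟨hP⟩
  let ι₁ : ZMod P →+ (Fin 1 → ZMod P) :=
    { toFun := fun x _ => x, map_zero' := rfl, map_add' := fun _ _ => rfl }
  have hι₁inj : Function.Injective ι₁ := fun x y hxy => congrFun hxy 0
  have hS'' := hS'.image ι₁ hι₁inj
  refine ⟨P, 1, hP.isPrimePow, N, fun i => (A' i).image ι₁, fun i => (B' i).image ι₁,
    fun i => (C' i).image ι₁, hS'', ?_⟩
  have hsum'' : ∑ i, ((((A' i).image ι₁).card * ((B' i).image ι₁).card * ((C' i).image ι₁).card : ℕ) : ℝ) ^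
      ((2 + ε) / 3) = S := by
    rw [← hS'sum]
    refine Finset.sum_congr rfl fun i _ => ?_
    rw [card_image_of_injective _ hι₁inj, card_image_of_injective _ hι₁inj,
      card_image_of_injective _ hι₁inj]
  rw [hsum'', pow_one]
  exact hPS

/-- **Kill side** (census K1/R1): the negative milestone `NoHomocyclicSTPP` (= ¬X′) excludes large-block
STPP designs in EVERY finite abelian group — the case Pratt 2024 Rem. 4.6 leaves open for Thm 4.4. -/
theorem not_largeBlockAbelianDesigns_of_noHomocyclicSTPP (hNo : NoHomocyclicSTPP) :
    ¬ ∃ α₀ : ℝ, 0 < α₀ ∧ ∀ ε : ℝ, 0 < ε →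
      ∃ (H : Type) (_ : AddCommGroup H) (_ : Fintype H) (N : ℕ) (A B C : Fin N → Finset H),
        IsSTPP A B C ∧
        (∀ i, (Fintype.card H : ℝ) ^ α₀ ≤ (((A i).card * (B i).card * (C i).card : ℕ) : ℝ)) ∧
        (Fintype.card H : ℝ) <
          ∑ i, (((A i).card * (B i).card * (C i).card : ℕ) : ℝ) ^ ((2 + ε) / 3) := fun h => by
  obtain ⟨ε, hε, hbound⟩ := hNo
  obtain ⟨q, ℓ, hq, N, A, B, C, hS, hlt⟩ := homocyclicSTPPDesigns_of_largeBlockAbelianDesigns h ε hε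
  exact absurd (hbound q ℓ hq N A B C hS) (not_le.2 hlt)

end Summit.MatrixMultiplication.MatrixMultiplication.Theorems.HomocyclicSTPPDesigns.LargeBlock
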